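import Summits.QuantumFields.QCD.Theorems.SpectralDefectExtinctionWindowExtinctionStubSpreadFromPartsR3
import Summits.QuantumFields.QCD.Theorems.SpectralDefectExtinctionWindowExtinctionSpreadR3Pi
import Summits.QuantumFields.QCD.Theorems.SpectralDefectExtinctionWindowExtinctionStubFluxTemplateHalf

/-!
# The tiled template class is measurable and Haar-positive (sub-goal TP of crux stmt-QuantumFields-8967)

Stub `tiledTemplate_measurable_pos` (lead c2, sub-goal TP of the modular cell–wall template) of line
`hermitian-flow-coarea` of crux `Summit.QuantumFields.QCD.Theses.SpectralDefectExtinction.TipPricing`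
(item stmt-QuantumFields-8967).

Templates `t : Tmpl R` assign `SU(3)` matrices to the links `(x, μ)` (`x ∈ {−R..R}⁴`, `μ : Fin 4`) of the big
box.  Given `N` cells `z k + {−ℓ..ℓ}⁴` with collars `z k + ({−(ℓ+W)..ℓ+W}⁴ ∖ {−ℓ..ℓ}⁴)`, cells-with-collars
pairwise disjoint and inside the big box, the tiled template class `Tp` consists of the templates whose every
cell content (read in cell-relative coordinates) lies in a measurable Haar-positive cell class `Tc` and whose
every collar link is entrywise `η`-close to the centre-flux pattern `diag(u,u,u)`, `u = e^{2πi y₀/3}` in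
direction `1`, `u = e^{2πi y₂/3}` in direction `3`, `u = 1` otherwise (`y` the cell-relative coordinate).

* `pi_cellCollar_measurable_ne_zero` — the abstract factorisation: on a finite product `(L → α, ν^{⊗L})` an event
  "the contents of the blocks `σ(i, ·)` of a bijectively labelled set `E ≃ I × K` of coordinates lie in `Tc`, and
  every coordinate `l` lies in `A l`" (with `A l = univ` on `E`) is measurable of measure
  `ν^{⊗K}(Tc)^{|I|} · ∏_{l ∉ E} ν(A l)`, hence non-zero when the factors are
  (`MeasureTheory.measurePreserving_piEquivPiSubtypeProd` to split off `E`, `spreadR3_measurePreserving_relabel`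
  to read `E` block by block, `Measure.pi_pi` twice).
* `tiledTemplate_phase_unit` — the pattern phases `e^{2πi m/3}` are unit complex numbers with cube `1`.
* `tiledTemplate_measurable_pos` — the stub: the cell links `(z k + y, μ)`, `y ∈ {−ℓ..ℓ}⁴`, are labelled
  bijectively by `Fin N × (↥(box 4 ℓ) × Fin 4)` (disjointness of the cells), the cell clause is the block event,
  the collar clause is a coordinate rectangle of open tubes (`fluxHalf_isOpen_tube`; each of positive Haar
  probability by `fluxHalf_haar_tube_ne_zero`, and trivial on cell links since collars miss cells).
-/

noncomputable section

namespace Summit.QuantumFields.QCD.Cruxes.TipPricing.ModularTemplate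

open MeasureTheory
open Literature.MathematicalPhysics.QuantumLattice Literature.MathematicalPhysics.QuantumFieldTheory
  Literature.Probability.LatticeModels
open Summit.QuantumFields.QCD.Cruxes.WindowExtinction.FreeVolumeHeavyWitness
open scoped BigOperators

/-! ### Abstract factorisation of a block-and-rectangle event -/

/-- **Block-and-rectangle events in a finite product space.**  Let `ν` be a probability measure on `α`, `L` a finite
index type, `E : Finset L` a set of coordinates labelled bijectively by `σ : I × K ≃ ↥E`, `Tc ⊆ (K → α)` measurable
with `ν^{⊗K}(Tc) ≠ 0`, and `A l ⊆ α` measurable with `ν(A l) ≠ 0`, `A l = univ` for `l ∈ E`.  Then the event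
`{t | (∀ i, (k ↦ t (σ (i,k))) ∈ Tc) ∧ ∀ l, t l ∈ A l}` is measurable and has non-zero `ν^{⊗L}`-measure
(its measure is `ν^{⊗K}(Tc)^{|I|} ∏_{l ∉ E} ν(A l)`). -/
theorem pi_cellCollar_measurable_ne_zero {L I K α : Type*} [Fintype L] [Fintype I] [Fintype K]
    [MeasurableSpace α] (ν : Measure α) [IsProbabilityMeasure ν] (E : Finset L) (σ : I × K ≃ ↥E)
    {Tc : Set (K → α)} (hTc : MeasurableSet Tc) (hTc0 : (Measure.pi fun _ : K => ν) Tc ≠ 0)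
    {A : L → Set α} (hA : ∀ l, MeasurableSet (A l)) (hA0 : ∀ l, ν (A l) ≠ 0)
    (hAE : ∀ l ∈ E, A l = Set.univ) :
    MeasurableSet {t : L → α | (∀ i, (fun k => t (σ (i, k))) ∈ Tc) ∧ ∀ l, t l ∈ A l} ∧
      (Measure.pi fun _ : L => ν) {t : L → α | (∀ i, (fun k => t (σ (i, k))) ∈ Tc) ∧ ∀ l, t l ∈ A l} ≠ 0 := by
  classical
  -- the block event on the coordinates of `E` and the rectangle on the complement
  set Acell : Set (↥E → α) := {a | ∀ i, (fun k => a (σ (i, k))) ∈ Tc} with hAcell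
  set Bcol : Set ({l // ¬ l ∈ E} → α) := Set.univ.pi fun l => A l.1 with hBcol
  have hAm : MeasurableSet Acell := by
    rw [hAcell, Set.setOf_forall]
    exact MeasurableSet.iInter fun i =>
      hTc.preimage (measurable_pi_lambda _ fun k => measurable_pi_apply _)
  have hBm : MeasurableSet Bcol := MeasurableSet.univ_pi fun l => hA l.1
  -- the splitting equivalence
  have he := measurePreserving_piEquivPiSubtypeProd (fun _ : L => ν) (fun l => l ∈ E)
  have hS : {t : L → α | (∀ i, (fun k => t (σ (i, k))) ∈ Tc) ∧ ∀ l, t l ∈ A l} =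
      MeasurableEquiv.piEquivPiSubtypeProd (fun _ : L => α) (fun l => l ∈ E) ⁻¹' (Acell ×ˢ Bcol) := by
    ext t
    change _ ↔ (fun l : ↥E => t l) ∈ Acell ∧ (fun l : {l // ¬ l ∈ E} => t l) ∈ Bcol
    simp only [hAcell, hBcol, Set.mem_setOf_eq, Set.mem_univ_pi]
    refine and_congr Iff.rfl ⟨fun h l => h l.1, fun h l => ?_⟩
    by_cases hl : l ∈ E
    · rw [hAE l hl]; trivial
    · exact h ⟨l, hl⟩
  refine ⟨hS ▸ (MeasurableEquiv.measurable _) (hAm.prod hBm), ?_⟩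
  rw [hS, he.measure_preimage_equiv, Measure.prod_prod]
  refine mul_ne_zero ?_ ?_
  · -- the block event, read block by block
    have hΦ := spreadR3_measurePreserving_relabel (I := I) (K := K) ν E σ
    have hpre : ⇑((MeasurableEquiv.curry I K α).symm.trans
        (MeasurableEquiv.piCongrLeft (fun _ : ↥E => α) σ)) ⁻¹' Acell = Set.univ.pi fun _ : I => Tc := by
      ext T
      simp only [Set.mem_preimage, hAcell, Set.mem_setOf_eq, Set.mem_univ_pi]
      refine forall_congr' fun i => ?_
      have hT : (fun k => ((MeasurableEquiv.curry I K α).symm.trans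
          (MeasurableEquiv.piCongrLeft (fun _ : ↥E => α) σ)) T (σ (i, k))) = T i :=
        funext fun k => by rw [spreadR3_relabel_apply, Equiv.symm_apply_apply]
      rw [hT]
    have key : (Measure.pi fun _ : ↥E => ν) Acell ≠ 0 := by
      rw [← hΦ.measure_preimage_equiv Acell, hpre, Measure.pi_pi]
      exact Finset.prod_ne_zero_iff.2 fun _ _ => hTc0
    convert key
  · rw [hBcol, Measure.pi_pi]
    exact Finset.prod_ne_zero_iff.2 fun l _ => hA0 l.1

/-! ### The pattern phases -/

/-- The centre-flux phases `e^{2πi m/3}` (`m : ℤ`) are unit complex numbers whose cube is `1`. -/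
theorem tiledTemplate_phase_unit (m : ℤ) :
    Complex.normSq (Complex.exp (2 * Real.pi * Complex.I * (m : ℂ) / 3)) = 1 ∧
      Complex.exp (2 * Real.pi * Complex.I * (m : ℂ) / 3) ^ 3 = 1 := by
  have hw : (2 * Real.pi * Complex.I * (m : ℂ) / 3 : ℂ) = ((2 * Real.pi * m / 3 : ℝ) : ℂ) * Complex.I := by
    push_cast; ring
  refine ⟨?_, ?_⟩
  · rw [Complex.normSq_eq_norm_sq, hw, Complex.norm_exp_ofReal_mul_I, one_pow]
  · rw [← Complex.exp_nat_mul]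
    have h3 : ((3 : ℕ) : ℂ) * (2 * Real.pi * Complex.I * (m : ℂ) / 3) = m * (2 * Real.pi * Complex.I) := by
      push_cast; ring
    rw [h3, Complex.exp_int_mul_two_pi_mul_I]

/-! ### The stub -/

/-- **TP. The tiled template class is measurable and Haar-positive.**  Cells `z k + {−ℓ..ℓ}⁴` with collars of width `W`
(cells-with-collars pairwise disjoint, inside `{−R..R}⁴`); the class of templates whose every cell content lies in the
Haar-positive measurable cell class `Tc` and whose every collar link is entrywise `η`-close (`η > 0`) to the centre-flux pattern
(cell-relative coordinates) is measurable and has positive product-Haar measure. -/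
theorem tiledTemplate_measurable_pos (ℓ W R N : ℕ) (z : Fin N → (Fin 4 → ℤ))
    (hin : ∀ k, ∀ (y : Fin 4 → ℤ), y ∈ box 4 (ℓ + W) → z k + y ∈ box 4 R)
    (hdisj : ∀ k k', k ≠ k' → ∀ (y y' : Fin 4 → ℤ), y ∈ box 4 (ℓ + W) → y' ∈ box 4 (ℓ + W) → z k + y ≠ z k' + y')
    (Tc : Set ((↥(box 4 ℓ) × Fin 4) → SU3)) (hTc : MeasurableSet Tc)
    (hTc0 : (Measure.pi fun _ : ↥(box 4 ℓ) × Fin 4 => haarProbability SU3) Tc ≠ 0) (η : ℝ) (hη : 0 < η) :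
    let Tp : Set (Tmpl R) := {t |
      (∀ k : Fin N, ∃ s ∈ Tc, ∀ (yi : ↥(box 4 ℓ) × Fin 4) (x : ↥(box 4 R)),
          (x : Fin 4 → ℤ) = z k + (yi.1 : Fin 4 → ℤ) → t (x, yi.2) = s yi) ∧
      (∀ (k : Fin N) (x : ↥(box 4 R)) (y : Fin 4 → ℤ), y ∈ box 4 (ℓ + W) → y ∉ box 4 ℓ →
          (x : Fin 4 → ℤ) = z k + y → ∀ (μ : Fin 4) (i j : Fin 3),
            ‖(↑(t (x, μ)) : Matrix (Fin 3) (Fin 3) ℂ) i j -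
                (if i = j then
                  (if μ = 1 then Complex.exp (2 * Real.pi * Complex.I * ((y 0 : ℤ) : ℂ) / 3)
                   else if μ = 3 then Complex.exp (2 * Real.pi * Complex.I * ((y 2 : ℤ) : ℂ) / 3) else 1)
                 else 0)‖ < η)}
    MeasurableSet Tp ∧ tmplHaar R Tp ≠ 0 := by
  intro Tp
  classical
  haveI : IsProbabilityMeasure (haarProbability SU3) :=
    ⟨by simpa [haarProbability] using Measure.haarMeasure_self (G := SU3) (K₀ := ⊤)⟩
  -- uniqueness of (cell, relative coordinate) for the sites of the cells-with-collars
  have huniq : ∀ (k k' : Fin N) (y y' : Fin 4 → ℤ), y ∈ box 4 (ℓ + W) → y' ∈ box 4 (ℓ + W) →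
      z k + y = z k' + y' → k = k' ∧ y = y' := by
    intro k k' y y' hy hy' h
    have hk : k = k' := by
      by_contra hne
      exact hdisj k k' hne y y' hy hy' h
    subst hk
    exact ⟨rfl, add_left_cancel h⟩
  have hsub : ∀ (y : Fin 4 → ℤ), y ∈ box 4 ℓ → y ∈ box 4 (ℓ + W) := fun y hy =>
    box_mono 4 (Nat.le_add_right ℓ W) hy
  have hmemR : ∀ (k : Fin N) (y : Fin 4 → ℤ), y ∈ box 4 ℓ → z k + y ∈ box 4 R := fun k y hy =>
    hin k y (hsub y hy)
  -- the centre-flux pattern phase of a collar link (direction `μ`, cell-relative coordinate `y`)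
  let pat : (Fin 4 → ℤ) → Fin 4 → ℂ := fun y μ =>
    if μ = 1 then Complex.exp (2 * Real.pi * Complex.I * ((y 0 : ℤ) : ℂ) / 3)
    else if μ = 3 then Complex.exp (2 * Real.pi * Complex.I * ((y 2 : ℤ) : ℂ) / 3) else 1
  have hpat : ∀ (y : Fin 4 → ℤ) (μ : Fin 4), Complex.normSq (pat y μ) = 1 ∧ pat y μ ^ 3 = 1 := by
    intro y μ
    simp only [pat]
    split_ifs
    · exact tiledTemplate_phase_unit (y 0)
    · exact tiledTemplate_phase_unit (y 2)
    · simp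
  -- the cell links, labelled by (cell, relative link)
  let lk : Fin N × (↥(box 4 ℓ) × Fin 4) → ↥(box 4 R) × Fin 4 := fun p =>
    (⟨z p.1 + (p.2.1 : Fin 4 → ℤ), hmemR p.1 p.2.1 p.2.1.2⟩, p.2.2)
  have hlk_inj : Function.Injective lk := by
    rintro ⟨k, yi, μ⟩ ⟨k', yi', μ'⟩ h
    have h1 : z k + (yi : Fin 4 → ℤ) = z k' + (yi' : Fin 4 → ℤ) :=
      congrArg (fun l : ↥(box 4 R) × Fin 4 => (l.1 : Fin 4 → ℤ)) h
    have h2 : μ = μ' := congrArg Prod.snd h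
    obtain ⟨rfl, hy⟩ := huniq k k' _ _ (hsub _ yi.2) (hsub _ yi'.2) h1
    rw [Subtype.ext hy, h2]
  let E : Finset (↥(box 4 R) × Fin 4) := Finset.univ.image lk
  let f : Fin N × (↥(box 4 ℓ) × Fin 4) → ↥E := fun p => ⟨lk p, Finset.mem_image_of_mem lk (Finset.mem_univ p)⟩
  have hf : Function.Bijective f := by
    refine ⟨fun p q h => hlk_inj (congrArg Subtype.val h), fun l => ?_⟩
    obtain ⟨p, -, hp⟩ := Finset.mem_image.1 l.2
    exact ⟨p, Subtype.ext hp⟩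
  let σ : Fin N × (↥(box 4 ℓ) × Fin 4) ≃ ↥E := Equiv.ofBijective f hf
  -- the collar rectangle
  let A : ↥(box 4 R) × Fin 4 → Set SU3 := fun l =>
    {g | ∀ (k : Fin N) (y : Fin 4 → ℤ), y ∈ box 4 (ℓ + W) → y ∉ box 4 ℓ → (l.1 : Fin 4 → ℤ) = z k + y →
      ∀ i j : Fin 3, ‖(g : Matrix (Fin 3) (Fin 3) ℂ) i j - (if i = j then pat y l.2 else 0)‖ < η}
  have hAm : ∀ l, MeasurableSet (A l) := by
    intro l
    refine measurableSet_setOf.2 (Measurable.forall fun k => Measurable.forall fun y =>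
      measurable_const.imp <| measurable_const.imp <| measurable_const.imp ?_)
    exact measurableSet_setOf.1
      (fluxHalf_isOpen_tube (fun i j => if i = j then pat y l.2 else 0) η).measurableSet
  have hA0 : ∀ l, haarProbability SU3 (A l) ≠ 0 := by
    intro l
    by_cases hex : ∃ (k : Fin N) (y : Fin 4 → ℤ), y ∈ box 4 (ℓ + W) ∧ y ∉ box 4 ℓ ∧ (l.1 : Fin 4 → ℤ) = z k + y
    · obtain ⟨k₀, y₀, h1, h2, h3⟩ := hex
      obtain ⟨hn, hc⟩ := hpat y₀ l.2
      refine fun h0 => fluxHalf_haar_tube_ne_zero (pat y₀ l.2) hn hc (half_pos hη)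
        (measure_mono_null ?_ h0)
      intro g hg k y hy1 hy2 hy3 i j
      obtain ⟨rfl, rfl⟩ := huniq k₀ k y₀ y h1 hy1 (h3.symm.trans hy3)
      calc ‖(g : Matrix (Fin 3) (Fin 3) ℂ) i j - (if i = j then pat y₀ l.2 else 0)‖
          = ‖(g : Matrix (Fin 3) (Fin 3) ℂ) i j - pat y₀ l.2 * (1 : Matrix (Fin 3) (Fin 3) ℂ) i j‖ := by
            rw [Matrix.one_apply, mul_ite, mul_one, mul_zero]
        _ ≤ η / 2 := hg i j
        _ < η := half_lt_self hη
    · have hA : A l = Set.univ :=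
        Set.eq_univ_of_forall fun g k y hy1 hy2 hy3 => (hex ⟨k, y, hy1, hy2, hy3⟩).elim
      rw [hA, measure_univ]
      exact one_ne_zero
  have hAE : ∀ l ∈ E, A l = Set.univ := by
    intro l hl
    obtain ⟨p, -, rfl⟩ := Finset.mem_image.1 hl
    refine Set.eq_univ_of_forall fun g k y hy1 hy2 hy3 => ?_
    exfalso
    obtain ⟨-, rfl⟩ := huniq p.1 k _ y (hsub _ p.2.1.2) hy1 hy3
    exact hy2 p.2.1.2
  obtain ⟨hm, h0⟩ :=
    pi_cellCollar_measurable_ne_zero (haarProbability SU3) E σ hTc hTc0 hAm hA0 hAE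
  -- identify `Tp` with the block-and-rectangle event
  have hTp : Tp = {t : Tmpl R | (∀ i, (fun k => t (σ (i, k))) ∈ Tc) ∧ ∀ l, t l ∈ A l} := by
    ext t
    simp only [Tp, Set.mem_setOf_eq]
    refine and_congr (forall_congr' fun k => ⟨?_, fun h => ⟨_, h, fun yi x hx => ?_⟩⟩) ⟨?_, ?_⟩
    · rintro ⟨s, hs, h⟩
      convert hs using 1
      exact funext fun yi => h yi ⟨z k + (yi.1 : Fin 4 → ℤ), hmemR k yi.1 yi.1.2⟩ rfl
    · rw [show x = ⟨z k + (yi.1 : Fin 4 → ℤ), hmemR k yi.1 yi.1.2⟩ from Subtype.ext hx]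
      rfl
    · exact fun h l k' y h1 h2 h3 i j => h k' l.1 y h1 h2 h3 l.2 i j
    · exact fun h k' x y h1 h2 h3 μ i j => h (x, μ) k' y h1 h2 h3 i j
  rw [hTp]
  exact ⟨hm, h0⟩

end Summit.QuantumFields.QCD.Cruxes.TipPricing.ModularTemplate

end
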